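import Summits.Ventures.PercRepro.Night2ThreeTwoEleven
import Summits.Ventures.PercRepro.Night2ThreeTwoSpanCondition
import Summits.Ventures.PercRepro.Night2ThreeTwoNonBad

/-!
# PercRepro — the cell `(3, 2)`: the fat plane and the bases through both of its missed points (night-2, gen 27)

Groundwork for the obstruction cells with `9 ≤ |V| ≤ 10`.  The fat member `B₀` of the cell (`|B₀ ∖ K| ≥ 4`,
`|G ∖ cl B₀| = 2`) gives a plane `P₀ = cl B₀ ∖ K` of `V` with `n − 2` points; `V ∖ P₀ = {a, b}`.  A covering basis
`X` of a target through BOTH missed points `a, b` (a «type B» basis, `X = {a, b, p, p′}` with `p, p′ ∈ P₀`) loses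
nothing unless some line of `V` carries `n − 3` points: its faces at `p`, `p′` are not members (their complements lie
in `P₀`, the span condition), and its faces at `a`, `b` miss at least three points of `V` (`P₀ ∩ cl (Q ∖ a)` lies on
the line `cl {p, p′}`, which has at most `n − 4` points), so `L1 (K ∪ X) ≤ 2 · 7/36 < 5/12 ≤ capS`.

* `rkN_clF_sdiff_coloops_le_three`: the plane of a member has rank `≤ 3` off the coloops;
* `rkN_inter_sdiff_coloops_le_two_of_hyperplanes`: two distinct hyperplanes of `G` meet, off `K`, in rank `≤ 2`;
* `face_notMem_Uq_of_mem_clF_fat`: a face at a point of `P₀` of a type-B basis is not a member;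
* **`faceLoss_sum_eq_zero_of_typeB`**: a type-B basis loses nothing when no line of `V` has `n − 3` points.
-/

namespace PercRepro.Shadow

open Finset PerFlat ThmH

variable {α : Type*} [DecidableEq α] {M : Matroid α} [M.Finite]

section Plane

variable {G : Finset α}

/-- `(G ∖ K) ∖ (H ∖ K) = G ∖ H` for `K ⊆ H`. -/
theorem sdiff_coloops_sdiff_eq {K H : Finset α} (hKH : K ⊆ H) : (G \ K) \ (H \ K) = G \ H := by
  ext a
  simp only [Finset.mem_sdiff, not_and, not_not]
  constructor
  · rintro ⟨⟨haG, haK⟩, h⟩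
    exact ⟨haG, fun haH => haK (h haH)⟩
  · rintro ⟨haG, haH⟩
    exact ⟨⟨haG, fun haK => haH (hKH haK)⟩, fun h => absurd h haH⟩

/-- The closure of a member of the cell has rank `3` off the coloops. -/
theorem rkN_clF_sdiff_coloops_le_three (hG : G ∈ flatsQ M (5 + 1)) (hd : (gr M \ G).card = 3)
    (hk : kColoops M G = 2) {B : Finset α} (hB : B ∈ thinMembers M 5 G) :
    rkN M (clF M B \ coloops M G) ≤ 3 := by
  have hd' : (gr M \ G).card ≤ 5 := by omega
  have hGg : G ⊆ gr M := (mem_flatsQ.1 hG).1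
  have hB' : B ∈ membersIn M (Uq M (5 + 2) 5) G := (mem_thinMembers.1 hB).1
  have hBU : B ∈ Uq M (5 + 2) 5 := (mem_membersIn.1 hB').1
  have hHG : clF M B ⊆ G := (mem_membersIn.1 hB').2
  have hKB : coloops M G ⊆ B := coloops_subset_of_mem_thinMembers hG hd' hB
  have hKH : coloops M G ⊆ clF M B := hKB.trans (subset_clF hBU)
  have h5 : rkN M (clF M B) = 5 := rkN_clF_eq_five_of_mem_Uq hBU
  have h := eRk_eq_kColoops_add_sdiff hGg hHG hKH
  rw [eRk_eq_rkN, eRk_eq_rkN, hk, h5] at h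
  have h' : ((5 : ℕ) : ℕ∞) = ((2 + rkN M (clF M B \ coloops M G) : ℕ) : ℕ∞) := by
    rw [Nat.cast_add]; exact_mod_cast h
  have h'' : 5 = 2 + rkN M (clF M B \ coloops M G) := by exact_mod_cast h'
  omega

/-- A thin member missing at most two points misses exactly two. -/
theorem card_sdiff_clF_eq_two_of_le (hG : G ∈ flatsQ M (5 + 1)) (hd : (gr M \ G).card = 3) {B : Finset α}
    (hB : B ∈ thinMembers M 5 G) (hm : (G \ clF M B).card ≤ 2) : (G \ clF M B).card = 2 := by
  have hd' : (gr M \ G).card ≤ 5 := by omega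
  have := two_le_card_sdiff_of_not_lay0 hG hd' (mem_thinMembers.1 hB).1 (mem_thinMembers.1 hB).2
  omega

/-- **Two distinct hyperplanes of `G` meet, off the coloops, in rank `≤ 2`**: `H` closed of rank `5`, `H′` of rank
`≤ 5`, both containing `K`, and a point `y ∈ H′ ∖ H`. -/
theorem rkN_inter_sdiff_coloops_le_two_of_hyperplanes (hG : G ∈ flatsQ M (5 + 1)) (hk : kColoops M G = 2)
    {H H' : Finset α} (hHG : H ⊆ G) (hH'G : H' ⊆ G) (hHcl : clF M H = H) (hH5 : rkN M H = 5)
    (hH'5 : rkN M H' ≤ 5) (hKH : coloops M G ⊆ H) (hKH' : coloops M G ⊆ H') {y : α} (hyH' : y ∈ H')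
    (hyH : y ∉ H) : rkN M ((H ∩ H') \ coloops M G) ≤ 2 := by
  have hGg : G ⊆ gr M := (mem_flatsQ.1 hG).1
  have hU6 : 6 ≤ rkN M (H ∪ H') := by
    have h1 : rkN M (insert y H) = rkN M H + 1 :=
      rkN_insert_of_notMem_clF (hGg (hH'G hyH')) (by rw [hHcl]; exact hyH)
    have h2 : insert y H ⊆ H ∪ H' := Finset.insert_subset (Finset.mem_union_right _ hyH') Finset.subset_union_left
    have := rkN_mono (M := M) h2
    omega
  have hsub := rkN_submod (M := M) H H'
  have hKI : coloops M G ⊆ H ∩ H' := Finset.subset_inter hKH hKH'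
  have hIG : H ∩ H' ⊆ G := Finset.inter_subset_left.trans hHG
  have h := eRk_eq_kColoops_add_sdiff hGg hIG hKI
  rw [eRk_eq_rkN, eRk_eq_rkN, hk] at h
  have h' : ((rkN M (H ∩ H') : ℕ) : ℕ∞) = ((2 + rkN M ((H ∩ H') \ coloops M G) : ℕ) : ℕ∞) := by
    rw [Nat.cast_add]; exact_mod_cast h
  have h'' : rkN M (H ∩ H') = 2 + rkN M ((H ∩ H') \ coloops M G) := by exact_mod_cast h'
  omega

/-- A point of a `4`-subset `X ⊆ G ∖ K` that contains `G ∖ cl B₀`: the face of `K ∪ X` at a point `w ∈ cl B₀` is not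
a member — its complement in `G` lies in `cl B₀ ∖ K`, of rank `≤ 3`. -/
theorem face_notMem_Uq_of_mem_clF_fat (hG : G ∈ flatsQ M (5 + 1)) (hd : (gr M \ G).card = 3)
    (hk : kColoops M G = 2) {B₀ : Finset α} (hB₀ : B₀ ∈ thinMembers M 5 G) {X : Finset α}
    (hXV : X ⊆ G \ coloops M G) (hab : G \ clF M B₀ ⊆ X) {w : α} (hw : w ∈ X) (hwH : w ∈ clF M B₀) :
    (coloops M G ∪ X).erase w ∉ Uq M (5 + 2) 5 := by
  intro hB
  have hKG : coloops M G ⊆ G := fun y hy => (mem_coloops.1 hy).1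
  have hBG : (coloops M G ∪ X).erase w ⊆ G :=
    (Finset.erase_subset w _).trans (Finset.union_subset hKG (hXV.trans Finset.sdiff_subset))
  have h4 := four_le_rkN_sdiff_of_mem_Uq hG hd hB hBG
  have h3 := rkN_clF_sdiff_coloops_le_three hG hd hk hB₀
  have hsub : G \ (coloops M G ∪ X).erase w ⊆ clF M B₀ \ coloops M G := by
    intro a ha
    simp only [Finset.mem_sdiff, Finset.mem_erase, Finset.mem_union, not_and, not_or] at ha
    obtain ⟨haG, h⟩ := ha
    rw [Finset.mem_sdiff]
    by_cases haw : a = w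
    · subst haw
      exact ⟨hwH, (Finset.mem_sdiff.1 (hXV hw)).2⟩
    · have h' := h haw
      refine ⟨?_, h'.1⟩
      by_contra haH
      exact h'.2 (hab (Finset.mem_sdiff.2 ⟨haG, haH⟩))
  have := rkN_mono (M := M) hsub
  omega

open scoped Classical in
/-- **A TYPE-B BASIS LOSES NOTHING WHEN NO LINE OF `V` CARRIES `n − 3` POINTS**: for a `4`-subset `X ⊆ V` with
`K ∪ X` independent and `G ∖ cl B₀ ⊆ X` (`B₀` the fat member, `|G ∖ cl B₀| ≤ 2`), the face losses of `K ∪ X` vanish: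
the faces at the two points of `X ∩ cl B₀` are not members, the faces at the two missed points each miss `≥ 3` points
of `G`, so `L1 (K ∪ X) ≤ 7/18 < 5/12 ≤ capS (K ∪ X)` and the covering set is not saturated. -/
theorem faceLoss_sum_eq_zero_of_typeB (hG : G ∈ flatsQ M (5 + 1)) (hd : (gr M \ G).card = 3)
    (hk : kColoops M G = 2) (hs : ∀ e ∈ gr M, ∀ f ∈ gr M, e ≠ f → rkN M {e, f} = 2)
    {B₀ : Finset α} (hB₀ : B₀ ∈ thinMembers M 5 G) (hm : (G \ clF M B₀).card ≤ 2)
    (hnoline : ∀ p ∈ G \ coloops M G, ∀ p' ∈ G \ coloops M G, p ≠ p' →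
      (clF M {p, p'} ∩ (G \ coloops M G)).card + 4 ≤ (G \ coloops M G).card)
    {X : Finset α} (hXV : X ⊆ G \ coloops M G) (hX4 : X.card = 4)
    (hXI : M.Indep ((coloops M G ∪ X : Finset α) : Set α)) (hab : G \ clF M B₀ ⊆ X) :
    ∑ w ∈ X, faceLoss M 5 G (coloops M G ∪ X) w = 0 := by
  have hd' : (gr M \ G).card ≤ 5 := by omega
  have hGg : G ⊆ gr M := (mem_flatsQ.1 hG).1
  have hKG : coloops M G ⊆ G := fun y hy => (mem_coloops.1 hy).1
  have hB₀' : B₀ ∈ membersIn M (Uq M (5 + 2) 5) G := (mem_thinMembers.1 hB₀).1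
  have hB₀U : B₀ ∈ Uq M (5 + 2) 5 := (mem_membersIn.1 hB₀').1
  have hH₀G : clF M B₀ ⊆ G := (mem_membersIn.1 hB₀').2
  have hKH₀ : coloops M G ⊆ clF M B₀ := (coloops_subset_of_mem_thinMembers hG hd' hB₀).trans (subset_clF hB₀U)
  have hm2 : (G \ clF M B₀).card = 2 := card_sdiff_clF_eq_two_of_le hG hd hB₀ hm
  have hXK : Disjoint X (coloops M G) := by
    rw [Finset.disjoint_left]; intro a ha haK
    exact (Finset.mem_sdiff.1 (hXV ha)).2 haK
  have hQcard : (coloops M G ∪ X).card = 6 := by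
    rw [Finset.card_union_of_disjoint hXK.symm, ← kColoops_eq_card_coloops, hk, hX4]
  set Q := coloops M G ∪ X with hQ
  have hQG : Q ⊆ G := Finset.union_subset hKG (hXV.trans Finset.sdiff_subset)
  have hKQ : coloops M G ⊆ Q := Finset.subset_union_left
  have hQK : Q \ coloops M G = X := by
    rw [hQ, Finset.union_sdiff_left, Finset.sdiff_eq_self_of_disjoint hXK]
  -- the plane `P₀ = cl B₀ ∖ K` has `n − 2` points
  have hP₀card : (clF M B₀ \ coloops M G).card + 2 = (G \ coloops M G).card := by
    have h1 : clF M B₀ \ coloops M G ⊆ G \ coloops M G := Finset.sdiff_subset_sdiff hH₀G (Finset.Subset.refl _)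
    have h2 := Finset.card_sdiff_of_subset h1
    rw [sdiff_coloops_sdiff_eq hKH₀, hm2] at h2
    have := Finset.card_le_card h1
    omega
  -- the two points of `X` on the plane
  have hXP : (X ∩ clF M B₀).card = 2 := by
    have h1 : X \ clF M B₀ = G \ clF M B₀ := by
      apply Finset.Subset.antisymm
      · intro a ha
        rw [Finset.mem_sdiff] at ha ⊢
        exact ⟨(Finset.mem_sdiff.1 (hXV ha.1)).1, ha.2⟩
      · intro a ha
        rw [Finset.mem_sdiff] at ha ⊢
        exact ⟨hab (Finset.mem_sdiff.2 ha), ha.2⟩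
    have h2 := Finset.card_sdiff_add_card_inter X (clF M B₀)
    rw [h1, hm2, hX4] at h2
    omega
  -- the faces at the points of the plane are not members, the faces at the missed points miss `≥ 3` points
  have hface_plane : ∀ w ∈ X, w ∈ clF M B₀ → Q.erase w ∉ Uq M (5 + 2) 5 :=
    fun w hw hwH => face_notMem_Uq_of_mem_clF_fat hG hd hk hB₀ hXV hab hw hwH
  have hface_missed : ∀ w ∈ X, w ∉ clF M B₀ → Q.erase w ∈ thinMembers M 5 G →
      3 ≤ (G \ clF M (Q.erase w)).card := by
    intro w hw hwH hthin
    have hwQ : w ∈ Q := Finset.mem_union_right _ hw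
    have hB'G : Q.erase w ⊆ G := (Finset.erase_subset w Q).trans hQG
    have hKB' : coloops M G ⊆ Q.erase w := coloops_subset_of_mem_thinMembers hG hd' hthin
    have hB'U : Q.erase w ∈ Uq M (5 + 2) 5 := (mem_membersIn.1 (mem_thinMembers.1 hthin).1).1
    have hH'G : clF M (Q.erase w) ⊆ G := (mem_membersIn.1 (mem_thinMembers.1 hthin).1).2
    have hKH' : coloops M G ⊆ clF M (Q.erase w) := hKB'.trans (subset_clF hB'U)
    have hH'5 : rkN M (clF M (Q.erase w)) ≤ 5 := by
      rw [rkN_clF]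
      have := rkN_le_card (M := M) (Q.erase w)
      have hc : (Q.erase w).card = 5 := by
        rw [Finset.card_erase_of_mem hwQ, hQcard]
      omega
    -- the other missed point `y` lies in `Q ∖ w ⊆ cl (Q ∖ w)` and not in `cl B₀`
    obtain ⟨y, hyX, hyw, hyH⟩ : ∃ y ∈ X, y ≠ w ∧ y ∉ clF M B₀ := by
      have h1 : X \ clF M B₀ = G \ clF M B₀ := by
        apply Finset.Subset.antisymm
        · intro a ha
          rw [Finset.mem_sdiff] at ha ⊢
          exact ⟨(Finset.mem_sdiff.1 (hXV ha.1)).1, ha.2⟩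
        · intro a ha
          rw [Finset.mem_sdiff] at ha ⊢
          exact ⟨hab (Finset.mem_sdiff.2 ha), ha.2⟩
      have hw' : w ∈ X \ clF M B₀ := Finset.mem_sdiff.2 ⟨hw, hwH⟩
      have h2 : ((X \ clF M B₀).erase w).card = 1 := by
        rw [Finset.card_erase_of_mem hw', h1, hm2]
      obtain ⟨y, hy⟩ := Finset.card_eq_one.1 h2
      have hyin : y ∈ (X \ clF M B₀).erase w := by rw [hy]; exact Finset.mem_singleton_self y
      rw [Finset.mem_erase, Finset.mem_sdiff] at hyin
      exact ⟨y, hyin.2.1, hyin.1, hyin.2.2⟩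
    have hyB' : y ∈ clF M (Q.erase w) := by
      apply subset_clF hB'U
      rw [Finset.mem_erase]
      exact ⟨hyw, Finset.mem_union_right _ hyX⟩
    -- the intersection `Y = (cl B₀ ∩ cl (Q ∖ w)) ∖ K` has rank `≤ 2` and contains the two plane points of `X`
    set Y := (clF M B₀ ∩ clF M (Q.erase w)) \ coloops M G with hY
    have hYr : rkN M Y ≤ 2 :=
      rkN_inter_sdiff_coloops_le_two_of_hyperplanes hG hk hH₀G hH'G (clF_clF B₀)
        (rkN_clF_eq_five_of_mem_Uq hB₀U) hH'5 hKH₀ hKH' hyB' hyH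
    have hYg : Y ⊆ gr M := Finset.sdiff_subset.trans (Finset.inter_subset_left.trans (hH₀G.trans hGg))
    have hXPY : X ∩ clF M B₀ ⊆ Y := by
      intro p hp
      rw [Finset.mem_inter] at hp
      rw [hY, Finset.mem_sdiff, Finset.mem_inter]
      refine ⟨⟨hp.2, subset_clF hB'U ?_⟩, (Finset.mem_sdiff.1 (hXV hp.1)).2⟩
      rw [Finset.mem_erase]
      exact ⟨fun h => hwH (h ▸ hp.2), Finset.mem_union_right _ hp.1⟩
    have hYsub : Y ⊆ clF M (Y ∩ (X ∩ clF M B₀)) := by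
      apply subset_clF_inter_of_rkN_le_two hs hYg hYr
      rw [Finset.inter_eq_right.2 hXPY, hXP]
    rw [Finset.inter_eq_right.2 hXPY] at hYsub
    -- the two plane points span a line with `≤ n − 4` points of `V`
    obtain ⟨p, p', hpp', hpair⟩ := Finset.card_eq_two.1 hXP
    have hpV : p ∈ G \ coloops M G := hXV (Finset.mem_inter.1 (by rw [hpair]; simp)).1
    have hp'V : p' ∈ G \ coloops M G := hXV (Finset.mem_inter.1 (by rw [hpair]; simp)).1
    have hline := hnoline p hpV p' hp'V hpp'
    rw [hpair] at hYsub
    have hYV : Y ⊆ clF M {p, p'} ∩ (G \ coloops M G) := by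
      intro a ha
      rw [Finset.mem_inter]
      refine ⟨hYsub ha, ?_⟩
      rw [hY, Finset.mem_sdiff, Finset.mem_inter] at ha
      exact Finset.mem_sdiff.2 ⟨hH₀G ha.1.1, ha.2⟩
    have hYcard := Finset.card_le_card hYV
    -- `G ∖ cl B′ ⊇ {w} ∪ (P₀ ∖ Y)`
    have hwB' : w ∈ G \ clF M (Q.erase w) := by
      rw [Finset.mem_sdiff]
      refine ⟨(Finset.mem_sdiff.1 (hXV hw)).1, fun hwcl => ?_⟩
      have hI : M.Indep ((Q.erase w : Finset α) : Set α) :=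
        hXI.subset (by exact_mod_cast (Finset.erase_subset w Q))
      have hI' : M.Indep ((insert w (Q.erase w) : Finset α) : Set α) := by
        rw [Finset.insert_erase hwQ]
        exact hXI
      have h1 : rkN M (insert w (Q.erase w)) = (insert w (Q.erase w)).card := rkN_eq_card_of_indep hI'
      have h2 : rkN M (Q.erase w) = (Q.erase w).card := rkN_eq_card_of_indep hI
      have h3 : rkN M (insert w (Q.erase w)) ≤ rkN M (Q.erase w) :=
        rkN_insert_le_of_mem_clF (hB'G.trans hGg) hwcl
      have h4 : (insert w (Q.erase w)).card = (Q.erase w).card + 1 :=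
        Finset.card_insert_of_notMem (Finset.notMem_erase w Q)
      omega
    have hP₀sub : (clF M B₀ \ coloops M G) \ Y ⊆ (G \ clF M (Q.erase w)).erase w := by
      intro a ha
      rw [Finset.mem_sdiff, Finset.mem_sdiff] at ha
      rw [Finset.mem_erase, Finset.mem_sdiff]
      refine ⟨fun haw => hwH (haw ▸ ha.1.1), hH₀G ha.1.1, fun hacl => ha.2 ?_⟩
      rw [hY, Finset.mem_sdiff, Finset.mem_inter]
      exact ⟨⟨ha.1.1, hacl⟩, ha.1.2⟩
    have h1 := Finset.card_le_card hP₀sub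
    rw [Finset.card_erase_of_mem hwB'] at h1
    have h2 : ((clF M B₀ \ coloops M G) \ Y).card + Y.card = (clF M B₀ \ coloops M G).card := by
      have hYP : Y ⊆ clF M B₀ \ coloops M G := by
        intro a ha
        rw [hY, Finset.mem_sdiff, Finset.mem_inter] at ha
        exact Finset.mem_sdiff.2 ⟨ha.1.1, ha.2⟩
      rw [Finset.card_sdiff_of_subset hYP]
      have := Finset.card_le_card hYP
      omega
    omega
  -- the covering set is not saturated: `L1 Q ≤ 7/18 < 5/12 ≤ capS Q`
  have hL1 : L1 M 5 G Q ≤ 7 / 18 := by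
    unfold L1
    set P := (coverPreimages M (Uq M (5 + 2) 5) G Q).filter (fun B => B ∉ lay0 M 5 G) with hP
    have hthin : ∀ B ∈ P, B ∈ thinMembers M 5 G := by
      intro B hB
      rw [hP, Finset.mem_filter, mem_coverPreimages] at hB
      exact mem_thinMembers.2 ⟨hB.1.1, hB.2⟩
    have hPsub : P ⊆ (X \ clF M B₀).image (fun w => Q.erase w) := by
      intro B hB
      have h1 := thin_coverPreimages_subset_image_coloops hG hd' Q hB
      rw [hQK] at h1
      obtain ⟨w, hw, rfl⟩ := Finset.mem_image.1 h1
      have hwX : w ∈ X := (mem_coloops.1 hw).1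
      rw [Finset.mem_image]
      refine ⟨w, Finset.mem_sdiff.2 ⟨hwX, fun hwH => ?_⟩, rfl⟩
      exact hface_plane w hwX hwH (mem_membersIn.1 (mem_thinMembers.1 (hthin _ hB)).1).1
    have hreq : ∀ B ∈ P, req M 5 B ≤ 7 / 36 := by
      intro B hB
      have h1 := hPsub hB
      obtain ⟨w, hw, rfl⟩ := Finset.mem_image.1 h1
      rw [Finset.mem_sdiff] at hw
      exact req_le_of_thin_three_two' hG hd (hthin _ hB) (hface_missed w hw.1 hw.2 (hthin _ hB))
    have hPcard : P.card ≤ 2 := by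
      calc P.card ≤ ((X \ clF M B₀).image (fun w => Q.erase w)).card := Finset.card_le_card hPsub
        _ ≤ (X \ clF M B₀).card := Finset.card_image_le
        _ ≤ (G \ clF M B₀).card := by
            apply Finset.card_le_card
            intro a ha
            rw [Finset.mem_sdiff] at ha ⊢
            exact ⟨(Finset.mem_sdiff.1 (hXV ha.1)).1, ha.2⟩
        _ = 2 := hm2
    calc ∑ B ∈ P, req M 5 B ≤ ∑ _B ∈ P, (7 / 36 : ℚ) := Finset.sum_le_sum hreq
      _ = (P.card : ℚ) * (7 / 36) := by rw [Finset.sum_const, nsmul_eq_mul]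
      _ ≤ 2 * (7 / 36) := by
          have : (P.card : ℚ) ≤ 2 := by exact_mod_cast hPcard
          nlinarith
      _ = 7 / 18 := by norm_num
  have hcap := capS_ge_five_twelfths_three_two hd hk hQG
  have hfS : fS M 5 G Q = 1 := by
    unfold fS
    rw [if_pos (by linarith)]
  apply Finset.sum_eq_zero
  intro w hw
  unfold faceLoss
  split_ifs with hcond
  · unfold loss
    rw [Finset.insert_erase (Finset.mem_union_right _ hw), hfS]
    ring
  · rfl

end Plane

end PercRepro.Shadow
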